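import Literature.NumberTheory.LFunctions.RepulsiveLogFreeDensitySingleModulus
import HarnessLib

/-!
# Log-free density theorems near `σ = 1` for a family of primitive characters, and the
# Deuring–Heilbronn phenomenon with separated conductors (Pintz, Banach Center Publ. 118 (2019):
# Theorems 2–4, Corollaries 2–3)

LABEL (cell `landau-siegel`, sub-cell §C literature harvest, rung F-S3, rows T-034/T-035/T-036 of
`lit/HARVEST.md`; tag **DH**: inexplicit log-free density / repulsion statements in the
Linnik–Zhang regime `T ≤ q^{o(1)}`, the shapes an explicit design over Zhang's pair `(χ mod D,
ψ mod p)` would cite). STATEMENT LAYER: five NAMED FACTS (D-0014; `def … : Prop`,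
theorem-in-print, nothing asserted; all implied constants `≪_ε`, `Y₀(ε)`, `c₀` INEXPLICIT in print and
therefore existentially quantified) — Theorem 2 (three log-free bounds for the number `J` of
distinct pairs `(χ, ρ)`, `χ` in a family `𝓗` of primitive characters of moduli `≤ M` with pairwise
conductors `cond χ_i χ̄_j ≤ K`, `ρ ∈ R(α,T)`, `α > 1 − ε³`), Corollary 2 (single character / single
modulus / all primitive characters of moduli `≤ Q` / `ζ`), Theorem 3 (`J ≪ ((KM)^{2φ+ε} T^{10/ε})^{1−α}`,
`φ = 1/4` for cube-free moduli, else `1/3`), Corollary 3, and Theorem 4 (Deuring–Heilbronn with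
`Y = (q₁² q₂ k (|γ|+2)²)^{3/8}`, `k = cond χ₁χ̄₂`) — over Mathlib's `DirichletCharacter` and the
tree's rectangle counts (`ThornerZaman2024PNTAP.zeroSetGe` / `charZeroCountGe` / `modZeroCount`,
`RepulsiveLogFreeDensitySingleModulus.lean`), plus a little PROVED bookkeeping.

## What the source prints (held text `paper:arxiv-1804.05552` = Banach Center Publ. 118 (2019)
231–244, doi:10.4064/bc118-14, corpus-tex chunks p0001–p0002, read 2026-08-26)

J. Pintz, *Some new density theorems for Dirichlet L-functions* [Pintz2019DensityTheorems].

§2 (p0001:L33–44): "Let `N(α,T,χ)` denote the number of zeros of `L(s,χ)` in the rectangle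
`R(α,T) = {σ + it; α ≤ σ ≤ 1, |t| ≤ T}` and let `N(α,T,q) = Σ_{χ (mod q)} N(α,T,χ)`,
`N*(α,T,Q) = Σ_{q≤Q} Σ*_{χ (mod q)} N(α,T,χ)`, where the asterisk indicates summation over
primitive characters."

> **Theorem 1, setting** (p0001:L66–71). Let `𝓗` be a set of primitive characters `χ` with moduli
> `≤ M` such that `cond χ_i χ̄_j ≤ K` for any pair `χ_i, χ_j` belonging to `𝓗`. Let `𝓢` be a set of
> distinct pairs `(χ_j, ϱ_j)` with `L(ϱ_j, χ_j) = 0`, where `χ_j ∈ 𝓗`, `ϱ_j ∈ R(α,T)`. (The same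
> character might naturally appear in `𝓢` several times with different zeros.) Let `J` denote the
> cardinality of `𝓢` and let `ε` be an arbitrary, sufficiently small positive number (`0 < ε < c₀`).

> **Theorem 2** (p0001:L94–p0002:L3). Under the conditions of Theorem 1 for `α > 1 − ε³`, `T ≥ 3`
> we have `J ≪_ε (K²(MT)^{3/4})^{(1+ε)(1−α)}`, `J ≪_ε (M²(KT)^{3/4})^{(1+ε)(1−α)}`,
> `J ≪_ε (M²K²T^{2ε})^{(1+ε)(1−α)}` (2.12).

> **Corollary 2** (p0002:L5–16). For `α > 1 − ε³`, `T ≥ 3` we have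
> `N(α,T,χ_q) ≪_ε (qT)^{(3/4+ε)(1−α)}`, `N(α,T,χ_q) ≪_ε (q²T^{2ε})^{(1+ε)(1−α)}`,
> `N(α,T,q) ≪_ε (q⁴T^{2ε})^{(1+ε)(1−α)}`, `N*(α,T,Q) ≪_ε (Q⁶T^{2ε})^{(1+ε)(1−α)}`,
> `N(α,T) ≪_ε T^{ε(1−α)}` (2.13).

> **Theorem 3** (p0002:L25–31). Suppose the conditions of Theorem 1 and let `φ = 1/4` if all
> characters in `𝓗` have cube-free moduli (or order at most `log M`), otherwise let `φ = 1/3`. Then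
> for `α > 1 − ε²`, `T ≥ 3` we have `J ≪_ε ((KM)^{2φ+ε} T^{10/ε})^{(1−α)}`.

> **Corollary 3** (p0002:L33–40). With the notation of Theorem 3 we have for `α > 1 − ε²`, `T ≥ 3`
> `N*(α,T,Q) ≪_ε (Q^{2+ε}T^{10/ε})^{1−α}`, `N(α,T,q) ≪_ε (q^{1+ε}T^{10/ε})^{(1−α)}` if `q` is
> cube-free, `(q^{4/3+ε}T^{10/ε})^{(1−α)}` otherwise.

> **Theorem 4** (p0002:L70–80). Let `χ₁` and `χ₂` be primitive characters mod `q₁` and `q₂`, resp.,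
> with `L(1 − δ₁, χ₁) = L(1 − δ + iγ, χ₂) = 0`, `χ₁, δ₁` real, `δ₁ < δ < 1/7`. Let `k` be the
> conductor of `χ₁χ̄₂`. Let `ε > 0` arbitrary, `Y = (q₁²q₂k(|γ|+2)²)^{3/8} ≥ Y₀(ε)` sufficiently
> large. Then we have `δ₁ ≥ (1 − ε)(1 − 6δ) log 2 · Y^{−(1+ε)δ/(1−6δ)}/log Y`.

("(The character `χ₂` may be equal to `χ₁`.)" p0002:L55.)

## Lean rendering / design choices (audit notes for ls-lit-ref)

* CHARACTERS OF VARYING MODULUS: a member of `𝓗` is a dependent pair `⟨i, χ⟩` with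
  `χ : DirichletCharacter ℂ (i+1)` (modulus `q = i + 1 ≥ 1`, so Mathlib's `LFunction` — which needs
  `NeZero q` — applies; the idiom of `ExplicitLogFreeZeroDensityDirichlet.lean`), type `PrimChar`.
  `cond χ_i χ̄_j` = the conductor of the product `χ_i · χ_j⁻¹` formed at the common level
  `q_i q_j` (`Pintz2019.condProd`; `χ̄ = χ⁻¹` for a Dirichlet character; Mathlib
  `DirichletCharacter.changeLevel`, `.conductor` — the conductor does not depend on the level at
  which the product is realised).
* `R(α,T) = {α ≤ σ ≤ 1, |t| ≤ T}`; the zeros of `L(s,χ)` in it = the tree's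
  `ThornerZaman2024PNTAP.zeroSetGe χ α T = {ρ : L(ρ,χ) = 0, α ≤ Re ρ, |Im ρ| ≤ T}` (the bound
  `Re ρ ≤ 1` is automatic for zeros). `J = #𝓢` for a set of DISTINCT pairs ⟹ the facts bound the
  `Set.ncard` of the full pair set `{(⟨i,χ⟩, ρ) : ⟨i,χ⟩ ∈ 𝓗, ρ ∈ zeroSetGe χ α T}` (`pairZeroSet`),
  which bounds every sub-family `𝓢`; accordingly `N(α,T,χ)` is rendered by the DISTINCT-zero count
  `charZeroCountGe` (`Set.ncard`, as Thorner–Zaman print it), `N(α,T,q)` by `modZeroCount q α T`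
  (all `χ mod q`), `N*(α,T,Q)` by `Pintz2019.primZeroCount` (primitive `χ` of moduli `q ≤ Q`), and
  `N(α,T)` (`ζ`) by the character `1 mod 1` (`L(s,1 mod 1) = ζ(s)`,
  `DirichletCharacter.LFunction_modOne_eq`). If the print means counts WITH multiplicity, the typed
  corollaries are WEAKER than print (distinct ≤ with multiplicity), never stronger.
* "`ε` arbitrary, sufficiently small (`0 < ε < c₀`)", "`≪_ε`", "`Y ≥ Y₀(ε)` sufficiently large" ⟹
  `∃ c₀ > 0, ∀ ε ∈ (0,c₀), ∃ C > 0, …` resp. `∀ ε > 0, ∃ Y₀, …` — all constants inexplicit in print.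
  `M, K, Q, q : ℕ`; `α ≤ 1` is implicit in print (`R(α,T) = ∅` otherwise) and added as a binder.
* Theorem 3's side condition: `φ = 1/4` when every modulus in `𝓗` is cube-free (`CubeFree`; the
  alternative "or order at most `log M`" is rendered as the second disjunct
  `orderOf χ ≤ log M`), `φ = 1/3` always.
* Theorem 4: `χ₁` real = `MulChar.IsQuadratic` (values in `{0, ±1}`); the two zeros as printed;
  `Y` as printed; conclusion as printed. No positivity of `δ₁` is assumed (for `δ₁ ≤ 0` the
  hypothesis `L(1 − δ₁, χ₁) = 0` is impossible for `q₁ > 1` and the bound is vacuous/true otherwise —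
  typed as printed).

WHAT THIS IS NOT: no explicit constants (none are printed); no claim about Siegel zeros. «The
programme SEARCHES and TYPES; no claim about Landau–Siegel zeros, Theorems 1–2 of
arXiv:2211.02515 or a repaired Margin232 until a kernel theorem says so.»

## References

* [Pintz2019DensityTheorems] J. Pintz, *Some new density theorems for Dirichlet L-functions*, in:
  Number Theory Week 2017, Banach Center Publ. 118 (2019) 231–244, doi:10.4064/bc118-14,
  arXiv:1804.05552: §2 (2.1)–(2.2), Theorem 1 (setting), Theorem 2 (2.12), Corollary 2 (2.13),
  Theorem 3, Corollary 3, Theorem 4.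
* Tree: `RepulsiveLogFreeDensitySingleModulus.lean` (`ThornerZaman2024PNTAP.zeroSetGe`,
  `charZeroCountGe`, `modZeroCount`), `ExplicitLogFreeZeroDensityDirichlet.lean` (family idiom).
-/

noncomputable section

open scoped Classical

namespace Literature.NumberTheory.LFunctions

namespace Pintz2019

open ThornerZaman2024PNTAP

/-! ### Families of primitive characters of varying modulus -/

/-- A Dirichlet character of modulus `i + 1` packaged with its modulus index `i`
(modulus `q = i + 1 ≥ 1`). [cite: Pintz2019DensityTheorems, Theorem 1 (setting)] -/
abbrev PrimChar : Type := (i : ℕ) × DirichletCharacter ℂ (i + 1)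

/-- The modulus `q = i + 1` of a packaged character. [cite: Pintz2019DensityTheorems, Theorem 1 (setting)] -/
def PrimChar.modulus (x : PrimChar) : ℕ := x.1 + 1

/-- **`cond χ_i χ̄_j`**: the conductor of `χ_i · χ_j⁻¹`, the product being formed at level
`q_i q_j`. [cite: Pintz2019DensityTheorems, Theorem 1 (setting)] -/
def condProd (x y : PrimChar) : ℕ :=
  (DirichletCharacter.changeLevel (dvd_mul_right (x.1 + 1) (y.1 + 1)) x.2 *
    DirichletCharacter.changeLevel (dvd_mul_left (y.1 + 1) (x.1 + 1)) y.2⁻¹).conductor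

/-- **The family hypothesis of Theorem 1**: `𝓗` consists of primitive characters with moduli `≤ M`
and `cond χ_i χ̄_j ≤ K` for every pair in `𝓗`. [cite: Pintz2019DensityTheorems, Theorem 1 (setting)] -/
def IsFamily (H : Set PrimChar) (M K : ℕ) : Prop :=
  (∀ x ∈ H, x.2.IsPrimitive ∧ x.modulus ≤ M) ∧ ∀ x ∈ H, ∀ y ∈ H, condProd x y ≤ K

/-- **The pairs `(χ, ϱ)`** with `χ ∈ 𝓗` and `ϱ ∈ R(α,T)` a zero of `L(s,χ)`; `J` of Theorem 1 is the
cardinality of a set of DISTINCT such pairs, hence at most the `Set.ncard` of this set.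
[cite: Pintz2019DensityTheorems, Theorem 1 (setting)] -/
def pairZeroSet (H : Set PrimChar) (α T : ℝ) : Set (PrimChar × ℂ) :=
  {p | p.1 ∈ H ∧ p.2 ∈ zeroSetGe p.1.2 α T}

/-- **`N*(α,T,Q) = Σ_{q ≤ Q} Σ*_{χ mod q} N(α,T,χ)`** (primitive characters; distinct zeros in
`R(α,T)`), moduli `q = i + 1 ≤ Q`. [cite: Pintz2019DensityTheorems, §2 (2.2)] -/
def primZeroCount (α T : ℝ) (Q : ℕ) : ℕ :=
  ∑ i ∈ Finset.range Q, ∑ χ : DirichletCharacter ℂ (i + 1),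
    if χ.IsPrimitive then charZeroCountGe χ α T else 0

/-- `q` is cube-free: no prime cube divides `q`. [cite: Pintz2019DensityTheorems, Theorem 3] -/
def CubeFree (q : ℕ) : Prop :=
  ∀ p : ℕ, p.Prime → ¬ p ^ 3 ∣ q

/-! ### API (proved) -/

/-- Membership in the pair set. [cite: Pintz2019DensityTheorems, Theorem 1 (setting)] -/
@[simp] theorem mem_pairZeroSet {H : Set PrimChar} {α T : ℝ} {p : PrimChar × ℂ} :
    p ∈ pairZeroSet H α T ↔ p.1 ∈ H ∧ p.1.2.LFunction p.2 = 0 ∧ α ≤ p.2.re ∧ |p.2.im| ≤ T := by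
  simp [pairZeroSet, zeroSetGe]

/-- The pair set is monotone in the family. [cite: Pintz2019DensityTheorems, Theorem 1 (setting)] -/
theorem pairZeroSet_mono {H H' : Set PrimChar} (h : H ⊆ H') (α T : ℝ) :
    pairZeroSet H α T ⊆ pairZeroSet H' α T :=
  fun _ hp => ⟨h hp.1, hp.2⟩

/-- A sub-family of a family is a family (with the same `M, K`). [cite: Pintz2019DensityTheorems, Theorem 1 (setting)] -/
theorem IsFamily.mono {H H' : Set PrimChar} {M K : ℕ} (h : IsFamily H' M K) (hsub : H ⊆ H') :
    IsFamily H M K :=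
  ⟨fun x hx => h.1 x (hsub hx), fun x hx y hy => h.2 x (hsub hx) y (hsub hy)⟩

/-- The pairs of the one-character family `{⟨i,χ⟩}` are in bijection with the zeros of `L(s,χ)`
in `R(α,T)`: their number is `N(α,T,χ)` (distinct count). [cite: Pintz2019DensityTheorems, Corollary 2] -/
theorem ncard_pairZeroSet_singleton (x : PrimChar) (α T : ℝ) :
    (pairZeroSet {x} α T).ncard = charZeroCountGe x.2 α T := by
  unfold charZeroCountGe
  have : pairZeroSet {x} α T = (fun ρ => (x, ρ)) '' zeroSetGe x.2 α T := by
    ext p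
    obtain ⟨y, ρ⟩ := p
    constructor
    · rintro ⟨hx, hρ⟩
      rw [Set.mem_singleton_iff] at hx
      subst hx
      exact ⟨ρ, hρ, rfl⟩
    · rintro ⟨ρ', hρ', h⟩
      rw [Prod.mk.injEq] at h
      obtain ⟨rfl, rfl⟩ := h
      exact ⟨Set.mem_singleton _, hρ'⟩
  rw [this, Set.ncard_image_of_injective _ (Prod.mk_right_injective x)]

end Pintz2019

open Pintz2019 ThornerZaman2024PNTAP

/-! ### The named facts -/

/-- **Pintz 2019, Theorem 2** (log-free density theorem for a family near `σ = 1`). Under the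
setting of Theorem 1 — `𝓗` a set of primitive characters with moduli `≤ M` and
`cond χ_i χ̄_j ≤ K` pairwise, `J` the number of distinct pairs `(χ, ϱ)` with `χ ∈ 𝓗`,
`L(ϱ,χ) = 0`, `ϱ ∈ R(α,T) = {α ≤ σ ≤ 1, |t| ≤ T}` — "for `α > 1 − ε³`, `T ≥ 3` we have
`J ≪_ε (K²(MT)^{3/4})^{(1+ε)(1−α)}`, `J ≪_ε (M²(KT)^{3/4})^{(1+ε)(1−α)}`,
`J ≪_ε (M²K²T^{2ε})^{(1+ε)(1−α)}`", for every sufficiently small `ε` (`0 < ε < c₀`). Implied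
constants inexplicit (`∃ c₀, ∃ C`). NAMED FACT, not proved here (Graham / Heath-Brown method with
Burgess-based bounds, §3). [cite: Pintz2019DensityTheorems, Theorem 2] -/
def pintz2019_theorem2 : Prop :=
  ∃ c₀ : ℝ, 0 < c₀ ∧ ∀ ε : ℝ, 0 < ε → ε < c₀ → ∃ C : ℝ, 0 < C ∧
    ∀ (H : Set PrimChar) (M K : ℕ), IsFamily H M K →
      ∀ α T : ℝ, 1 - ε ^ 3 < α → α ≤ 1 → 3 ≤ T →
        ((pairZeroSet H α T).ncard : ℝ) ≤
            C * ((K : ℝ) ^ 2 * ((M : ℝ) * T) ^ (3 / 4 : ℝ)) ^ ((1 + ε) * (1 - α)) ∧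
          ((pairZeroSet H α T).ncard : ℝ) ≤
            C * ((M : ℝ) ^ 2 * ((K : ℝ) * T) ^ (3 / 4 : ℝ)) ^ ((1 + ε) * (1 - α)) ∧
          ((pairZeroSet H α T).ncard : ℝ) ≤
            C * ((M : ℝ) ^ 2 * (K : ℝ) ^ 2 * T ^ (2 * ε)) ^ ((1 + ε) * (1 - α))

/-- **Pintz 2019, Corollary 2** (of Theorem 2). "For `α > 1 − ε³`, `T ≥ 3` we have
`N(α,T,χ_q) ≪_ε (qT)^{(3/4+ε)(1−α)}`, `N(α,T,χ_q) ≪_ε (q²T^{2ε})^{(1+ε)(1−α)}`,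
`N(α,T,q) ≪_ε (q⁴T^{2ε})^{(1+ε)(1−α)}`, `N*(α,T,Q) ≪_ε (Q⁶T^{2ε})^{(1+ε)(1−α)}`,
`N(α,T) ≪_ε T^{ε(1−α)}`" — `χ_q` a primitive character mod `q`, `N(α,T,q)` over all `χ mod q`,
`N*` over the primitive characters of moduli `≤ Q`, `N(α,T)` the zeros of `ζ` (`= L(s, 1 mod 1)`),
counts of DISTINCT zeros in `R(α,T)` (see the module docstring), `0 < ε < c₀`, constants
inexplicit. NAMED FACT, not proved here. [cite: Pintz2019DensityTheorems, Corollary 2] -/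
def pintz2019_corollary2 : Prop :=
  ∃ c₀ : ℝ, 0 < c₀ ∧ ∀ ε : ℝ, 0 < ε → ε < c₀ → ∃ C : ℝ, 0 < C ∧
    ∀ α T : ℝ, 1 - ε ^ 3 < α → α ≤ 1 → 3 ≤ T →
      (∀ (q : ℕ) [NeZero q] (χ : DirichletCharacter ℂ q), χ.IsPrimitive →
          (charZeroCountGe χ α T : ℝ) ≤ C * ((q : ℝ) * T) ^ ((3 / 4 + ε) * (1 - α)) ∧
            (charZeroCountGe χ α T : ℝ) ≤
              C * ((q : ℝ) ^ 2 * T ^ (2 * ε)) ^ ((1 + ε) * (1 - α))) ∧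
        (∀ (q : ℕ) [NeZero q],
          (modZeroCount q α T : ℝ) ≤ C * ((q : ℝ) ^ 4 * T ^ (2 * ε)) ^ ((1 + ε) * (1 - α))) ∧
        (∀ Q : ℕ,
          (primZeroCount α T Q : ℝ) ≤ C * ((Q : ℝ) ^ 6 * T ^ (2 * ε)) ^ ((1 + ε) * (1 - α))) ∧
        (charZeroCountGe (1 : DirichletCharacter ℂ 1) α T : ℝ) ≤ C * T ^ (ε * (1 - α))

/-- **Pintz 2019, Theorem 3** (the Linnik regime: `T`-dependence `T^{10/ε}`, conductor exponent
`2φ + ε`). Under the setting of Theorem 1, "let `φ = 1/4` if all characters in `𝓗` have cube-free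
moduli (or order at most `log M`), otherwise let `φ = 1/3`. Then for `α > 1 − ε²`, `T ≥ 3` we have
`J ≪_ε ((KM)^{2φ+ε} T^{10/ε})^{(1−α)}`" (`0 < ε < c₀`, constants inexplicit). NAMED FACT, not
proved here (a generalisation of Heath-Brown's Lemma 11.1). [cite: Pintz2019DensityTheorems, Theorem 3] -/
def pintz2019_theorem3 : Prop :=
  ∃ c₀ : ℝ, 0 < c₀ ∧ ∀ ε : ℝ, 0 < ε → ε < c₀ → ∃ C : ℝ, 0 < C ∧
    ∀ (H : Set PrimChar) (M K : ℕ), IsFamily H M K →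
      ∀ α T : ℝ, 1 - ε ^ 2 < α → α ≤ 1 → 3 ≤ T →
        ((pairZeroSet H α T).ncard : ℝ) ≤
            C * (((K : ℝ) * M) ^ (2 * (1 / 3 : ℝ) + ε) * T ^ (10 / ε)) ^ (1 - α) ∧
          (((∀ x ∈ H, CubeFree x.modulus) ∨ (∀ x ∈ H, (orderOf x.2 : ℝ) ≤ Real.log M)) →
            ((pairZeroSet H α T).ncard : ℝ) ≤
              C * (((K : ℝ) * M) ^ (2 * (1 / 4 : ℝ) + ε) * T ^ (10 / ε)) ^ (1 - α))

/-- **Pintz 2019, Corollary 3** (of Theorem 3). "For `α > 1 − ε²`, `T ≥ 3`: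
`N*(α,T,Q) ≪_ε (Q^{2+ε}T^{10/ε})^{1−α}`, `N(α,T,q) ≪_ε (q^{1+ε}T^{10/ε})^{(1−α)}` if `q` is
cube-free, `(q^{4/3+ε}T^{10/ε})^{(1−α)}` otherwise" (distinct-zero counts, `0 < ε < c₀`, constants
inexplicit). NAMED FACT, not proved here. [cite: Pintz2019DensityTheorems, Corollary 3] -/
def pintz2019_corollary3 : Prop :=
  ∃ c₀ : ℝ, 0 < c₀ ∧ ∀ ε : ℝ, 0 < ε → ε < c₀ → ∃ C : ℝ, 0 < C ∧
    ∀ α T : ℝ, 1 - ε ^ 2 < α → α ≤ 1 → 3 ≤ T →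
      (∀ Q : ℕ, (primZeroCount α T Q : ℝ) ≤ C * ((Q : ℝ) ^ (2 + ε) * T ^ (10 / ε)) ^ (1 - α)) ∧
        ∀ (q : ℕ) [NeZero q],
          (modZeroCount q α T : ℝ) ≤ C * ((q : ℝ) ^ (4 / 3 + ε) * T ^ (10 / ε)) ^ (1 - α) ∧
            (CubeFree q →
              (modZeroCount q α T : ℝ) ≤ C * ((q : ℝ) ^ (1 + ε) * T ^ (10 / ε)) ^ (1 - α))

/-- **Pintz 2019, Theorem 4** (Deuring–Heilbronn phenomenon with the conductor of `χ₁χ̄₂`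
separated). "Let `χ₁` and `χ₂` be primitive characters mod `q₁` and `q₂`, resp., with
`L(1 − δ₁, χ₁) = L(1 − δ + iγ, χ₂) = 0`, `χ₁, δ₁` real, `δ₁ < δ < 1/7`. Let `k` be the conductor of
`χ₁χ̄₂`. Let `ε > 0` arbitrary, `Y = (q₁²q₂k(|γ|+2)²)^{3/8} ≥ Y₀(ε)` sufficiently large. Then we
have `δ₁ ≥ (1 − ε)(1 − 6δ) log 2 · Y^{−(1+ε)δ/(1−6δ)}/log Y`." (`χ₂` may equal `χ₁`; `Y₀(ε)`
inexplicit: `∀ ε > 0, ∃ Y₀`.) NAMED FACT, not proved here (Turán's power sum + §3 bounds).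
[cite: Pintz2019DensityTheorems, Theorem 4] -/
def pintz2019_theorem4 : Prop :=
  ∀ ε : ℝ, 0 < ε → ∃ Y₀ : ℝ,
    ∀ (i₁ i₂ : ℕ) (χ₁ : DirichletCharacter ℂ (i₁ + 1)) (χ₂ : DirichletCharacter ℂ (i₂ + 1))
      (δ₁ δ γ : ℝ),
      χ₁.IsPrimitive → χ₂.IsPrimitive → χ₁.IsQuadratic →
        χ₁.LFunction ((1 - δ₁ : ℝ) : ℂ) = 0 → χ₂.LFunction (1 - δ + γ * Complex.I) = 0 →
          δ₁ < δ → δ < 1 / 7 →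
            let Y : ℝ := (((i₁ + 1 : ℕ) : ℝ) ^ 2 * ((i₂ + 1 : ℕ) : ℝ) *
              (condProd ⟨i₁, χ₁⟩ ⟨i₂, χ₂⟩ : ℝ) * (|γ| + 2) ^ 2) ^ (3 / 8 : ℝ)
            Y₀ ≤ Y →
              (1 - ε) * (1 - 6 * δ) * Real.log 2 * Y ^ (-((1 + ε) * δ / (1 - 6 * δ))) /
                  Real.log Y ≤ δ₁

/-! ### Bookkeeping (proved) -/

/-- Theorem 2, first bound, specialised to the one-character family `𝓗 = {χ}` (`M = q`,
`K = cond(χχ̄) ≤ K₀` whatever it is): the shape `N(α,T,χ) ≤ C (K₀²(qT)^{3/4})^{(1+ε)(1−α)}` — the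
bookkeeping from the pair-set statement to a single character's count.
[cite: Pintz2019DensityTheorems, Corollary 2] -/
theorem pintz2019_theorem2.single (h : pintz2019_theorem2) :
    ∃ c₀ : ℝ, 0 < c₀ ∧ ∀ ε : ℝ, 0 < ε → ε < c₀ → ∃ C : ℝ, 0 < C ∧
      ∀ (x : PrimChar) (K : ℕ), x.2.IsPrimitive → condProd x x ≤ K →
        ∀ α T : ℝ, 1 - ε ^ 3 < α → α ≤ 1 → 3 ≤ T →
          (charZeroCountGe x.2 α T : ℝ) ≤
            C * ((K : ℝ) ^ 2 * ((x.modulus : ℝ) * T) ^ (3 / 4 : ℝ)) ^ ((1 + ε) * (1 - α)) := by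
  obtain ⟨c₀, hc₀, hε⟩ := h
  refine ⟨c₀, hc₀, fun ε hε0 hεc => ?_⟩
  obtain ⟨C, hC, hH⟩ := hε ε hε0 hεc
  refine ⟨C, hC, fun x K hprim hK α T hα hα1 hT => ?_⟩
  have hfam : IsFamily {x} x.modulus K :=
    ⟨fun y hy => by rw [Set.mem_singleton_iff] at hy; subst hy; exact ⟨hprim, le_rfl⟩,
      fun y hy z hz => by
        rw [Set.mem_singleton_iff] at hy hz; subst hy; subst hz; exact hK⟩
  have := (hH {x} x.modulus K hfam α T hα hα1 hT).1
  rwa [ncard_pairZeroSet_singleton] at this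

end Literature.NumberTheory.LFunctions

end
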